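import Summits.HodgeConjecture.HodgeConjecture.Theorems.Ring2WeilNormObstructionDescent
import Summits.HodgeConjecture.HodgeConjecture.Theorems.Ring2WeilCoverageNormCriteria
import HarnessLib

/-!
# Non-split certificates for the genus fields of the census, part A (`h_K = 2`: `d = 5, 6, 10`)

research route conditional on HC_CM; not a corollary; Q11.4-sentence-2 already refuted in dim ≥ 3.

Cell `pub-hodge-ring2`, binder seat `ring2-b02` (gen 50), WEIL-TYPE FAMILY-COVERAGE CENSUS
(`run/shared/lean/pub/pub-hodge-ring2/WEIL-FAMILY-COVERAGE.md` §b02.4 compact rows). Companion of this seat's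
`Ring2WeilNormObstructionDescentCensus` (the 16 TARGET rows) and of ring2-b04's `Ring2WeilCoverageNormTable`
(square-free `a ≤ 15` on `d ∈ {1, 2, 3}`): here the NON-SPLIT certificates `a ∉ Nm(K_dˣ)`, `K_d = ℚ(√-d)`
(`Motives.normUnitsSubgroup ℚ (VanGeemen1994.weilField d)`), and the sixfold / tenfold class form
`[-a] ≠ Ring2.Hypotheses.splitDiscriminantClass n d` (every ODD `n`), for the classes listed below — each by ONE
prime of the obstruction set `T(a) = {p : (a, -d)_p = -1}`: an INERT prime `p ∥ a` (ring2-b04's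
`Ring2.WeilCoverage.natCast_not_mem_normUnitsSubgroup_of_inert`: `-d` non-square mod `p`) or, when both primes of
`T(a)` ramify, a RAMIFIED `p ∣ d`, `p ∤ a` with `a` non-square mod `p` (`…_of_ramified`); the class form by this
seat's `Ring2WeilNormDescent.mk_neg_ne_splitDiscriminantClass_of_odd`. Nothing here is about Hodge classes: these are
the arithmetic «(F1) NO hyperbolic member» cells of the census (Landherr / van Geemen (5.4.1): hyperbolic ⟺ `a ∈ Nm(K^×)`,
in the tree `VanGeemen1994.isHyperbolicWeilType_iff_hasWeilDiscriminantNondeg_split`).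

| `K` | `d` | `a` (least square-free representative) | `T(a)` | certificate prime |
|---|---|---|---|---|
| `ℚ(√-5)` | 5 | 2 | {2, 5} | ram 5 |
| `ℚ(√-5)` | 5 | 11 | {2, 11} | inert 11 |
| `ℚ(√-5)` | 5 | 26 | {2, 13} | inert 13 |
| `ℚ(√-5)` | 5 | 34 | {2, 17} | inert 17 |
| `ℚ(√-5)` | 5 | 22 | {5, 11} | inert 11 |
| `ℚ(√-5)` | 5 | 13 | {5, 13} | inert 13 |
| `ℚ(√-6)` | 6 | 2 | {2, 3} | ram 3 |
| `ℚ(√-6)` | 6 | 13 | {2, 13} | inert 13 |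
| `ℚ(√-6)` | 6 | 34 | {2, 17} | inert 17 |
| `ℚ(√-6)` | 6 | 19 | {2, 19} | inert 19 |
| `ℚ(√-6)` | 6 | 26 | {3, 13} | inert 13 |
| `ℚ(√-6)` | 6 | 17 | {3, 17} | inert 17 |
| `ℚ(√-10)` | 10 | 6 | {2, 3} | inert 3 |
| `ℚ(√-10)` | 10 | 2 | {2, 5} | ram 5 |
| `ℚ(√-10)` | 10 | 34 | {2, 17} | inert 17 |
| `ℚ(√-10)` | 10 | 29 | {2, 29} | inert 29 |
| `ℚ(√-10)` | 10 | 3 | {3, 5} | inert 3 |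
| `ℚ(√-10)` | 10 | 51 | {3, 17} | inert 3 |

## References
* B. van Geemen, LNM 1594 (1994), Lemma 5.2, 5.4 and (5.4.1) (after W. Landherr 1936). [vanGeemen1994HodgeAV]
* J.-P. Serre, *A Course in Arithmetic* (1973), Ch. III §1 (Hilbert symbols). [Serre1973]
-/

open Literature.AlgebraicGeometry.Motives
open Literature.AlgebraicGeometry.VanGeemen1994
open Summit.HodgeConjecture.HodgeConjecture.Ring2.Hypotheses
open Summit.HodgeConjecture.HodgeConjecture.Ring2.WeilCoverage

namespace Summit.HodgeConjecture.Ring2WeilNormDescent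

/-! ### `K = ℚ(√-5)` (`d = 5`; first five non-split primes `S₅ = [2, 5, 11, 13, 17]`) -/

namespace SqrtNeg5

/-- `2 ∉ Nm(ℚ(√-5)ˣ)`, `T(2) = {2, 5}`, at the ramified prime `5 ∣ 5`, `2` non-square mod `5` (both primes of `T` ramify). research route conditional on HC_CM; not a corollary; Q11.4-sentence-2 already refuted in dim ≥ 3. [cite: vanGeemen1994HodgeAV, (5.4.1)] -/
theorem not_mem_2 : Units.mk0 (2 : ℚ) (by norm_num) ∉ normUnitsSubgroup ℚ (weilField 5) := by
  simpa using natCast_not_mem_normUnitsSubgroup_of_ramified (d := 5) (a := 2) (p := 5)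
    (by norm_num) (by norm_num) (by norm_num) (by decide) (by norm_num)

/-- `[-2] ≠ split`: the components `(n, ℚ(√-5), a ≡ 2)`, `n` odd, have NO hyperbolic member (row W6.5.2). research route conditional on HC_CM; not a corollary; Q11.4-sentence-2 already refuted in dim ≥ 3. [cite: vanGeemen1994HodgeAV, (5.4.1)] -/
theorem neg_2_ne_split_of_odd {n : ℕ} (hn : Odd n) :
    (QuotientGroup.mk (Units.mk0 (-2 : ℚ) (by norm_num)) : weilNormResidueGroup 5) ≠ splitDiscriminantClass n 5 :=
  mk_neg_ne_splitDiscriminantClass_of_odd _ not_mem_2 hn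

/-- `11 ∉ Nm(ℚ(√-5)ˣ)`, `T(11) = {2, 11}`, at the inert prime `11 ∥ 11` (`-5` non-square mod `11`). research route conditional on HC_CM; not a corollary; Q11.4-sentence-2 already refuted in dim ≥ 3. [cite: vanGeemen1994HodgeAV, (5.4.1)] -/
theorem not_mem_11 : Units.mk0 (11 : ℚ) (by norm_num) ∉ normUnitsSubgroup ℚ (weilField 5) := by
  simpa using natCast_not_mem_normUnitsSubgroup_of_inert (d := 5) (a := 11) (p := 11)
    (by norm_num) (by decide) (by norm_num) (by norm_num) (by norm_num)

/-- `[-11] ≠ split`: the components `(n, ℚ(√-5), a ≡ 11)`, `n` odd, have NO hyperbolic member (row W6.5.11). research route conditional on HC_CM; not a corollary; Q11.4-sentence-2 already refuted in dim ≥ 3. [cite: vanGeemen1994HodgeAV, (5.4.1)] -/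
theorem neg_11_ne_split_of_odd {n : ℕ} (hn : Odd n) :
    (QuotientGroup.mk (Units.mk0 (-11 : ℚ) (by norm_num)) : weilNormResidueGroup 5) ≠ splitDiscriminantClass n 5 :=
  mk_neg_ne_splitDiscriminantClass_of_odd _ not_mem_11 hn

/-- `26 ∉ Nm(ℚ(√-5)ˣ)`, `T(26) = {2, 13}`, at the inert prime `13 ∥ 26` (`-5` non-square mod `13`). research route conditional on HC_CM; not a corollary; Q11.4-sentence-2 already refuted in dim ≥ 3. [cite: vanGeemen1994HodgeAV, (5.4.1)] -/
theorem not_mem_26 : Units.mk0 (26 : ℚ) (by norm_num) ∉ normUnitsSubgroup ℚ (weilField 5) := by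
  simpa using natCast_not_mem_normUnitsSubgroup_of_inert (d := 5) (a := 26) (p := 13)
    (by norm_num) (by decide) (by norm_num) (by norm_num) (by norm_num)

/-- `[-26] ≠ split`: the components `(n, ℚ(√-5), a ≡ 26)`, `n` odd, have NO hyperbolic member (row W6.5.26). research route conditional on HC_CM; not a corollary; Q11.4-sentence-2 already refuted in dim ≥ 3. [cite: vanGeemen1994HodgeAV, (5.4.1)] -/
theorem neg_26_ne_split_of_odd {n : ℕ} (hn : Odd n) :
    (QuotientGroup.mk (Units.mk0 (-26 : ℚ) (by norm_num)) : weilNormResidueGroup 5) ≠ splitDiscriminantClass n 5 :=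
  mk_neg_ne_splitDiscriminantClass_of_odd _ not_mem_26 hn

/-- `34 ∉ Nm(ℚ(√-5)ˣ)`, `T(34) = {2, 17}`, at the inert prime `17 ∥ 34` (`-5` non-square mod `17`). research route conditional on HC_CM; not a corollary; Q11.4-sentence-2 already refuted in dim ≥ 3. [cite: vanGeemen1994HodgeAV, (5.4.1)] -/
theorem not_mem_34 : Units.mk0 (34 : ℚ) (by norm_num) ∉ normUnitsSubgroup ℚ (weilField 5) := by
  simpa using natCast_not_mem_normUnitsSubgroup_of_inert (d := 5) (a := 34) (p := 17)
    (by norm_num) (by decide) (by norm_num) (by norm_num) (by norm_num)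

/-- `[-34] ≠ split`: the components `(n, ℚ(√-5), a ≡ 34)`, `n` odd, have NO hyperbolic member (row W6.5.34). research route conditional on HC_CM; not a corollary; Q11.4-sentence-2 already refuted in dim ≥ 3. [cite: vanGeemen1994HodgeAV, (5.4.1)] -/
theorem neg_34_ne_split_of_odd {n : ℕ} (hn : Odd n) :
    (QuotientGroup.mk (Units.mk0 (-34 : ℚ) (by norm_num)) : weilNormResidueGroup 5) ≠ splitDiscriminantClass n 5 :=
  mk_neg_ne_splitDiscriminantClass_of_odd _ not_mem_34 hn

/-- `22 ∉ Nm(ℚ(√-5)ˣ)`, `T(22) = {5, 11}`, at the inert prime `11 ∥ 22` (`-5` non-square mod `11`). research route conditional on HC_CM; not a corollary; Q11.4-sentence-2 already refuted in dim ≥ 3. [cite: vanGeemen1994HodgeAV, (5.4.1)] -/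
theorem not_mem_22 : Units.mk0 (22 : ℚ) (by norm_num) ∉ normUnitsSubgroup ℚ (weilField 5) := by
  simpa using natCast_not_mem_normUnitsSubgroup_of_inert (d := 5) (a := 22) (p := 11)
    (by norm_num) (by decide) (by norm_num) (by norm_num) (by norm_num)

/-- `[-22] ≠ split`: the components `(n, ℚ(√-5), a ≡ 22)`, `n` odd, have NO hyperbolic member (row W6.5.22). research route conditional on HC_CM; not a corollary; Q11.4-sentence-2 already refuted in dim ≥ 3. [cite: vanGeemen1994HodgeAV, (5.4.1)] -/
theorem neg_22_ne_split_of_odd {n : ℕ} (hn : Odd n) :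
    (QuotientGroup.mk (Units.mk0 (-22 : ℚ) (by norm_num)) : weilNormResidueGroup 5) ≠ splitDiscriminantClass n 5 :=
  mk_neg_ne_splitDiscriminantClass_of_odd _ not_mem_22 hn

/-- `13 ∉ Nm(ℚ(√-5)ˣ)`, `T(13) = {5, 13}`, at the inert prime `13 ∥ 13` (`-5` non-square mod `13`). research route conditional on HC_CM; not a corollary; Q11.4-sentence-2 already refuted in dim ≥ 3. [cite: vanGeemen1994HodgeAV, (5.4.1)] -/
theorem not_mem_13 : Units.mk0 (13 : ℚ) (by norm_num) ∉ normUnitsSubgroup ℚ (weilField 5) := by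
  simpa using natCast_not_mem_normUnitsSubgroup_of_inert (d := 5) (a := 13) (p := 13)
    (by norm_num) (by decide) (by norm_num) (by norm_num) (by norm_num)

/-- `[-13] ≠ split`: the components `(n, ℚ(√-5), a ≡ 13)`, `n` odd, have NO hyperbolic member (row W6.5.13). research route conditional on HC_CM; not a corollary; Q11.4-sentence-2 already refuted in dim ≥ 3. [cite: vanGeemen1994HodgeAV, (5.4.1)] -/
theorem neg_13_ne_split_of_odd {n : ℕ} (hn : Odd n) :
    (QuotientGroup.mk (Units.mk0 (-13 : ℚ) (by norm_num)) : weilNormResidueGroup 5) ≠ splitDiscriminantClass n 5 :=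
  mk_neg_ne_splitDiscriminantClass_of_odd _ not_mem_13 hn

end SqrtNeg5

/-! ### `K = ℚ(√-6)` (`d = 6`; first five non-split primes `S₅ = [2, 3, 13, 17, 19]`) -/

namespace SqrtNeg6

/-- `2 ∉ Nm(ℚ(√-6)ˣ)`, `T(2) = {2, 3}`, at the ramified prime `3 ∣ 6`, `2` non-square mod `3` (both primes of `T` ramify). research route conditional on HC_CM; not a corollary; Q11.4-sentence-2 already refuted in dim ≥ 3. [cite: vanGeemen1994HodgeAV, (5.4.1)] -/
theorem not_mem_2 : Units.mk0 (2 : ℚ) (by norm_num) ∉ normUnitsSubgroup ℚ (weilField 6) := by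
  simpa using natCast_not_mem_normUnitsSubgroup_of_ramified (d := 6) (a := 2) (p := 3)
    (by norm_num) (by norm_num) (by norm_num) (by decide) (by norm_num)

/-- `[-2] ≠ split`: the components `(n, ℚ(√-6), a ≡ 2)`, `n` odd, have NO hyperbolic member (row W6.6.2). research route conditional on HC_CM; not a corollary; Q11.4-sentence-2 already refuted in dim ≥ 3. [cite: vanGeemen1994HodgeAV, (5.4.1)] -/
theorem neg_2_ne_split_of_odd {n : ℕ} (hn : Odd n) :
    (QuotientGroup.mk (Units.mk0 (-2 : ℚ) (by norm_num)) : weilNormResidueGroup 6) ≠ splitDiscriminantClass n 6 :=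
  mk_neg_ne_splitDiscriminantClass_of_odd _ not_mem_2 hn

/-- `13 ∉ Nm(ℚ(√-6)ˣ)`, `T(13) = {2, 13}`, at the inert prime `13 ∥ 13` (`-6` non-square mod `13`). research route conditional on HC_CM; not a corollary; Q11.4-sentence-2 already refuted in dim ≥ 3. [cite: vanGeemen1994HodgeAV, (5.4.1)] -/
theorem not_mem_13 : Units.mk0 (13 : ℚ) (by norm_num) ∉ normUnitsSubgroup ℚ (weilField 6) := by
  simpa using natCast_not_mem_normUnitsSubgroup_of_inert (d := 6) (a := 13) (p := 13)
    (by norm_num) (by decide) (by norm_num) (by norm_num) (by norm_num)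

/-- `[-13] ≠ split`: the components `(n, ℚ(√-6), a ≡ 13)`, `n` odd, have NO hyperbolic member (row W6.6.13). research route conditional on HC_CM; not a corollary; Q11.4-sentence-2 already refuted in dim ≥ 3. [cite: vanGeemen1994HodgeAV, (5.4.1)] -/
theorem neg_13_ne_split_of_odd {n : ℕ} (hn : Odd n) :
    (QuotientGroup.mk (Units.mk0 (-13 : ℚ) (by norm_num)) : weilNormResidueGroup 6) ≠ splitDiscriminantClass n 6 :=
  mk_neg_ne_splitDiscriminantClass_of_odd _ not_mem_13 hn

/-- `34 ∉ Nm(ℚ(√-6)ˣ)`, `T(34) = {2, 17}`, at the inert prime `17 ∥ 34` (`-6` non-square mod `17`). research route conditional on HC_CM; not a corollary; Q11.4-sentence-2 already refuted in dim ≥ 3. [cite: vanGeemen1994HodgeAV, (5.4.1)] -/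
theorem not_mem_34 : Units.mk0 (34 : ℚ) (by norm_num) ∉ normUnitsSubgroup ℚ (weilField 6) := by
  simpa using natCast_not_mem_normUnitsSubgroup_of_inert (d := 6) (a := 34) (p := 17)
    (by norm_num) (by decide) (by norm_num) (by norm_num) (by norm_num)

/-- `[-34] ≠ split`: the components `(n, ℚ(√-6), a ≡ 34)`, `n` odd, have NO hyperbolic member (row W6.6.34). research route conditional on HC_CM; not a corollary; Q11.4-sentence-2 already refuted in dim ≥ 3. [cite: vanGeemen1994HodgeAV, (5.4.1)] -/
theorem neg_34_ne_split_of_odd {n : ℕ} (hn : Odd n) :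
    (QuotientGroup.mk (Units.mk0 (-34 : ℚ) (by norm_num)) : weilNormResidueGroup 6) ≠ splitDiscriminantClass n 6 :=
  mk_neg_ne_splitDiscriminantClass_of_odd _ not_mem_34 hn

/-- `19 ∉ Nm(ℚ(√-6)ˣ)`, `T(19) = {2, 19}`, at the inert prime `19 ∥ 19` (`-6` non-square mod `19`). research route conditional on HC_CM; not a corollary; Q11.4-sentence-2 already refuted in dim ≥ 3. [cite: vanGeemen1994HodgeAV, (5.4.1)] -/
theorem not_mem_19 : Units.mk0 (19 : ℚ) (by norm_num) ∉ normUnitsSubgroup ℚ (weilField 6) := by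
  simpa using natCast_not_mem_normUnitsSubgroup_of_inert (d := 6) (a := 19) (p := 19)
    (by norm_num) (by decide) (by norm_num) (by norm_num) (by norm_num)

/-- `[-19] ≠ split`: the components `(n, ℚ(√-6), a ≡ 19)`, `n` odd, have NO hyperbolic member (row W6.6.19). research route conditional on HC_CM; not a corollary; Q11.4-sentence-2 already refuted in dim ≥ 3. [cite: vanGeemen1994HodgeAV, (5.4.1)] -/
theorem neg_19_ne_split_of_odd {n : ℕ} (hn : Odd n) :
    (QuotientGroup.mk (Units.mk0 (-19 : ℚ) (by norm_num)) : weilNormResidueGroup 6) ≠ splitDiscriminantClass n 6 :=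
  mk_neg_ne_splitDiscriminantClass_of_odd _ not_mem_19 hn

/-- `26 ∉ Nm(ℚ(√-6)ˣ)`, `T(26) = {3, 13}`, at the inert prime `13 ∥ 26` (`-6` non-square mod `13`). research route conditional on HC_CM; not a corollary; Q11.4-sentence-2 already refuted in dim ≥ 3. [cite: vanGeemen1994HodgeAV, (5.4.1)] -/
theorem not_mem_26 : Units.mk0 (26 : ℚ) (by norm_num) ∉ normUnitsSubgroup ℚ (weilField 6) := by
  simpa using natCast_not_mem_normUnitsSubgroup_of_inert (d := 6) (a := 26) (p := 13)
    (by norm_num) (by decide) (by norm_num) (by norm_num) (by norm_num)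

/-- `[-26] ≠ split`: the components `(n, ℚ(√-6), a ≡ 26)`, `n` odd, have NO hyperbolic member (row W6.6.26). research route conditional on HC_CM; not a corollary; Q11.4-sentence-2 already refuted in dim ≥ 3. [cite: vanGeemen1994HodgeAV, (5.4.1)] -/
theorem neg_26_ne_split_of_odd {n : ℕ} (hn : Odd n) :
    (QuotientGroup.mk (Units.mk0 (-26 : ℚ) (by norm_num)) : weilNormResidueGroup 6) ≠ splitDiscriminantClass n 6 :=
  mk_neg_ne_splitDiscriminantClass_of_odd _ not_mem_26 hn

/-- `17 ∉ Nm(ℚ(√-6)ˣ)`, `T(17) = {3, 17}`, at the inert prime `17 ∥ 17` (`-6` non-square mod `17`). research route conditional on HC_CM; not a corollary; Q11.4-sentence-2 already refuted in dim ≥ 3. [cite: vanGeemen1994HodgeAV, (5.4.1)] -/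
theorem not_mem_17 : Units.mk0 (17 : ℚ) (by norm_num) ∉ normUnitsSubgroup ℚ (weilField 6) := by
  simpa using natCast_not_mem_normUnitsSubgroup_of_inert (d := 6) (a := 17) (p := 17)
    (by norm_num) (by decide) (by norm_num) (by norm_num) (by norm_num)

/-- `[-17] ≠ split`: the components `(n, ℚ(√-6), a ≡ 17)`, `n` odd, have NO hyperbolic member (row W6.6.17). research route conditional on HC_CM; not a corollary; Q11.4-sentence-2 already refuted in dim ≥ 3. [cite: vanGeemen1994HodgeAV, (5.4.1)] -/
theorem neg_17_ne_split_of_odd {n : ℕ} (hn : Odd n) :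
    (QuotientGroup.mk (Units.mk0 (-17 : ℚ) (by norm_num)) : weilNormResidueGroup 6) ≠ splitDiscriminantClass n 6 :=
  mk_neg_ne_splitDiscriminantClass_of_odd _ not_mem_17 hn

end SqrtNeg6

/-! ### `K = ℚ(√-10)` (`d = 10`; first five non-split primes `S₅ = [2, 3, 5, 17, 29]`) -/

namespace SqrtNeg10

/-- `6 ∉ Nm(ℚ(√-10)ˣ)`, `T(6) = {2, 3}`, at the inert prime `3 ∥ 6` (`-10` non-square mod `3`). research route conditional on HC_CM; not a corollary; Q11.4-sentence-2 already refuted in dim ≥ 3. [cite: vanGeemen1994HodgeAV, (5.4.1)] -/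
theorem not_mem_6 : Units.mk0 (6 : ℚ) (by norm_num) ∉ normUnitsSubgroup ℚ (weilField 10) := by
  simpa using natCast_not_mem_normUnitsSubgroup_of_inert (d := 10) (a := 6) (p := 3)
    (by norm_num) (by decide) (by norm_num) (by norm_num) (by norm_num)

/-- `[-6] ≠ split`: the components `(n, ℚ(√-10), a ≡ 6)`, `n` odd, have NO hyperbolic member (row W6.10.6). research route conditional on HC_CM; not a corollary; Q11.4-sentence-2 already refuted in dim ≥ 3. [cite: vanGeemen1994HodgeAV, (5.4.1)] -/
theorem neg_6_ne_split_of_odd {n : ℕ} (hn : Odd n) :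
    (QuotientGroup.mk (Units.mk0 (-6 : ℚ) (by norm_num)) : weilNormResidueGroup 10) ≠ splitDiscriminantClass n 10 :=
  mk_neg_ne_splitDiscriminantClass_of_odd _ not_mem_6 hn

/-- `2 ∉ Nm(ℚ(√-10)ˣ)`, `T(2) = {2, 5}`, at the ramified prime `5 ∣ 10`, `2` non-square mod `5` (both primes of `T` ramify). research route conditional on HC_CM; not a corollary; Q11.4-sentence-2 already refuted in dim ≥ 3. [cite: vanGeemen1994HodgeAV, (5.4.1)] -/
theorem not_mem_2 : Units.mk0 (2 : ℚ) (by norm_num) ∉ normUnitsSubgroup ℚ (weilField 10) := by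
  simpa using natCast_not_mem_normUnitsSubgroup_of_ramified (d := 10) (a := 2) (p := 5)
    (by norm_num) (by norm_num) (by norm_num) (by decide) (by norm_num)

/-- `[-2] ≠ split`: the components `(n, ℚ(√-10), a ≡ 2)`, `n` odd, have NO hyperbolic member (row W6.10.2). research route conditional on HC_CM; not a corollary; Q11.4-sentence-2 already refuted in dim ≥ 3. [cite: vanGeemen1994HodgeAV, (5.4.1)] -/
theorem neg_2_ne_split_of_odd {n : ℕ} (hn : Odd n) :
    (QuotientGroup.mk (Units.mk0 (-2 : ℚ) (by norm_num)) : weilNormResidueGroup 10) ≠ splitDiscriminantClass n 10 :=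
  mk_neg_ne_splitDiscriminantClass_of_odd _ not_mem_2 hn

/-- `34 ∉ Nm(ℚ(√-10)ˣ)`, `T(34) = {2, 17}`, at the inert prime `17 ∥ 34` (`-10` non-square mod `17`). research route conditional on HC_CM; not a corollary; Q11.4-sentence-2 already refuted in dim ≥ 3. [cite: vanGeemen1994HodgeAV, (5.4.1)] -/
theorem not_mem_34 : Units.mk0 (34 : ℚ) (by norm_num) ∉ normUnitsSubgroup ℚ (weilField 10) := by
  simpa using natCast_not_mem_normUnitsSubgroup_of_inert (d := 10) (a := 34) (p := 17)
    (by norm_num) (by decide) (by norm_num) (by norm_num) (by norm_num)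

/-- `[-34] ≠ split`: the components `(n, ℚ(√-10), a ≡ 34)`, `n` odd, have NO hyperbolic member (row W6.10.34). research route conditional on HC_CM; not a corollary; Q11.4-sentence-2 already refuted in dim ≥ 3. [cite: vanGeemen1994HodgeAV, (5.4.1)] -/
theorem neg_34_ne_split_of_odd {n : ℕ} (hn : Odd n) :
    (QuotientGroup.mk (Units.mk0 (-34 : ℚ) (by norm_num)) : weilNormResidueGroup 10) ≠ splitDiscriminantClass n 10 :=
  mk_neg_ne_splitDiscriminantClass_of_odd _ not_mem_34 hn

/-- `29 ∉ Nm(ℚ(√-10)ˣ)`, `T(29) = {2, 29}`, at the inert prime `29 ∥ 29` (`-10` non-square mod `29`). research route conditional on HC_CM; not a corollary; Q11.4-sentence-2 already refuted in dim ≥ 3. [cite: vanGeemen1994HodgeAV, (5.4.1)] -/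
theorem not_mem_29 : Units.mk0 (29 : ℚ) (by norm_num) ∉ normUnitsSubgroup ℚ (weilField 10) := by
  simpa using natCast_not_mem_normUnitsSubgroup_of_inert (d := 10) (a := 29) (p := 29)
    (by norm_num) (by decide) (by norm_num) (by norm_num) (by norm_num)

/-- `[-29] ≠ split`: the components `(n, ℚ(√-10), a ≡ 29)`, `n` odd, have NO hyperbolic member (row W6.10.29). research route conditional on HC_CM; not a corollary; Q11.4-sentence-2 already refuted in dim ≥ 3. [cite: vanGeemen1994HodgeAV, (5.4.1)] -/
theorem neg_29_ne_split_of_odd {n : ℕ} (hn : Odd n) :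
    (QuotientGroup.mk (Units.mk0 (-29 : ℚ) (by norm_num)) : weilNormResidueGroup 10) ≠ splitDiscriminantClass n 10 :=
  mk_neg_ne_splitDiscriminantClass_of_odd _ not_mem_29 hn

/-- `3 ∉ Nm(ℚ(√-10)ˣ)`, `T(3) = {3, 5}`, at the inert prime `3 ∥ 3` (`-10` non-square mod `3`). research route conditional on HC_CM; not a corollary; Q11.4-sentence-2 already refuted in dim ≥ 3. [cite: vanGeemen1994HodgeAV, (5.4.1)] -/
theorem not_mem_3 : Units.mk0 (3 : ℚ) (by norm_num) ∉ normUnitsSubgroup ℚ (weilField 10) := by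
  simpa using natCast_not_mem_normUnitsSubgroup_of_inert (d := 10) (a := 3) (p := 3)
    (by norm_num) (by decide) (by norm_num) (by norm_num) (by norm_num)

/-- `[-3] ≠ split`: the components `(n, ℚ(√-10), a ≡ 3)`, `n` odd, have NO hyperbolic member (row W6.10.3). research route conditional on HC_CM; not a corollary; Q11.4-sentence-2 already refuted in dim ≥ 3. [cite: vanGeemen1994HodgeAV, (5.4.1)] -/
theorem neg_3_ne_split_of_odd {n : ℕ} (hn : Odd n) :
    (QuotientGroup.mk (Units.mk0 (-3 : ℚ) (by norm_num)) : weilNormResidueGroup 10) ≠ splitDiscriminantClass n 10 :=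
  mk_neg_ne_splitDiscriminantClass_of_odd _ not_mem_3 hn

/-- `51 ∉ Nm(ℚ(√-10)ˣ)`, `T(51) = {3, 17}`, at the inert prime `3 ∥ 51` (`-10` non-square mod `3`). research route conditional on HC_CM; not a corollary; Q11.4-sentence-2 already refuted in dim ≥ 3. [cite: vanGeemen1994HodgeAV, (5.4.1)] -/
theorem not_mem_51 : Units.mk0 (51 : ℚ) (by norm_num) ∉ normUnitsSubgroup ℚ (weilField 10) := by
  simpa using natCast_not_mem_normUnitsSubgroup_of_inert (d := 10) (a := 51) (p := 3)
    (by norm_num) (by decide) (by norm_num) (by norm_num) (by norm_num)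

/-- `[-51] ≠ split`: the components `(n, ℚ(√-10), a ≡ 51)`, `n` odd, have NO hyperbolic member (row W6.10.51). research route conditional on HC_CM; not a corollary; Q11.4-sentence-2 already refuted in dim ≥ 3. [cite: vanGeemen1994HodgeAV, (5.4.1)] -/
theorem neg_51_ne_split_of_odd {n : ℕ} (hn : Odd n) :
    (QuotientGroup.mk (Units.mk0 (-51 : ℚ) (by norm_num)) : weilNormResidueGroup 10) ≠ splitDiscriminantClass n 10 :=
  mk_neg_ne_splitDiscriminantClass_of_odd _ not_mem_51 hn

end SqrtNeg10

end Summit.HodgeConjecture.Ring2WeilNormDescent
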